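import Summits.AtomisticToContinuum.HydrodynamicLimit.Theorems.JaynesSqueezeHardSphereLDAFreeEnergyMeasurable
import Summits.AtomisticToContinuum.HydrodynamicLimit.Theorems.JaynesSqueezeHardSphereLDADensityTools
import HarnessLib

/-!
# Hard-sphere local density approximation, VIII: the mean empirical density (measurable profiles)

Helper file for the support item `HardSphereLDA` (stmt-AtomisticToContinuum-13459) of route
`JaynesSqueeze`: clause (B3) of the item — under the canonical local Gibbs law with the thermodynamic
activity `α_σ(ρ) = ρ e^{g_σ(ρ)}` of a MEASURABLE unit-mass density `ρ` (`0 < c ≤ ρ`, `ρσ³ ≤ η_d`), the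
mean empirical density tested against a continuous `χ` converges to `∫ χ ρ`
(`tendsto_meanDensity_measurable`).

Proof (convexity, no cluster expansion beyond clause (B1)): perturb the density along
`ρ_s = ρ + s w`, `w = (χ − κ)/h_σ′(ρ)` with `κ` fixing `∫ w = 0`; by the convexity lower bound of file Ia
at the activity `α_σ(ρ)` with tilt `ψ_s = h_σ(ρ_s) − h_σ(ρ) = s(χ − κ) + O(s²)` (second-order Taylor,
file II), `s (E_N[χ] − κ) ≤ Λ_N(ρ_s) − Λ_N(ρ) + O(s²)`; clause (B1) for measurable profiles (file VII)
gives `Λ_N(ρ_s) − Λ_N(ρ) → V_σ(ρ_s) − V_σ(ρ) = s ∫ v_σ′(ρ) w + O(s²) = s (∫ χρ − κ) + O(s²)`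
(`v_σ′(r) = r h_σ′(r) − 1`, `∫ w = 0`, `∫ ρ = 1`); dividing by `s ≷ 0` and letting `s → 0` pins
`E_N[χ] → ∫ χ ρ` (the generic tools are in file VIIIa). No definitions. prover-pitem-stmt-AtomisticToContinuum-13459-0.
-/

noncomputable section

namespace Summit.AtomisticToContinuum.HydrodynamicLimit.Theorems.HardSphereLDA

open MeasureTheory Filter Set Topology
open scoped ENNReal
open Literature.MathematicalPhysics.KineticTheory Literature.Analysis.FluidPDE
open Summit.AtomisticToContinuum.HydrodynamicLimit.Theorems.KineticWindowGronwallActivityInversion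

/-! ### The mean empirical density at the thermodynamic activity: measurable profiles -/

section Core

variable {η₀ : ℝ} {F : ℝ → ℝ} (hη₀ : 0 < η₀) (hFa : AnalyticOnNhd ℝ F (Ioo (-η₀) η₀))
  (hEq : EqOn hsExcessFreeEnergy F (Ico 0 η₀))
  (hfree : ∀ η ∈ Ico 0 η₀, Tendsto (fun N : ℕ => -(N : ℝ)⁻¹ * Real.log (hsFreeVolume η N)) atTop (𝓝 (F η)))
  {r : ℝ} {Rf : ℝ → ℝ} {η₂ : ℝ} (hr : 0 < r)
  (hsol : ∀ x ∈ Ioo (-r) r, 0 < Rf x ∧ Rf x * (∑' j : ℕ, bE j / (j.factorial : ℝ) * (x * Rf x) ^ j) = 1)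
  (hbd : ∀ x ∈ Icc 0 r, 1 ≤ Rf x ∧ Rf x ≤ 2) (hcont : ContinuousOn Rf (Icc 0 r))
  (huniq : ∀ x ∈ Ioo (-r) r, ∀ R ∈ Icc (1 / 2 : ℝ) 2,
    R * (∑' j : ℕ, bE j / (j.factorial : ℝ) * (x * R) ^ j) = 1 → R = Rf x)
  (hη₂ : 0 < η₂)
  (hexp : ∀ η ∈ Ioo 0 η₂, Real.exp (hsExcessFreeEnergy η + η * deriv hsExcessFreeEnergy η) = Rf η)
include hη₀ hFa hEq hfree hr hsol hbd hcont huniq hη₂ hexp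

/-- **CLAUSE (B3) FOR MEASURABLE PROFILES.** Under `HsEosLowDensity` and the insertion-factor
package there is `η_d > 0` such that for all `σ > 0`, `c > 0`, all measurable unit-mass densities
`ρ` with `c ≤ ρ`, `ρσ³ ≤ η_d`, and all continuous `χ`, the canonical Gibbs mean of the empirical
density `(N+1)⁻¹ ∑ χ(xᵢ)` at the thermodynamic activity `α_σ(ρ)` tends to `∫ χ ρ`. [folklore] -/
theorem tendsto_meanDensity_measurable :
    ∃ ηd : ℝ, 0 < ηd ∧ ∀ σ : ℝ, 0 < σ → ∀ c : ℝ, 0 < c → ∀ ρ : T3 → ℝ, Measurable ρ → (∀ x, c ≤ ρ x) →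
      (∫ x, ρ x) = 1 → (∀ x, ρ x * σ ^ 3 ≤ ηd) → ∀ χ : T3 → ℝ, Continuous χ →
      Tendsto (fun N : ℕ => (posPartition (thermoActivity σ ρ) (hsDiameter σ N) (N + 1))⁻¹ *
          ∫ x, posWeight (thermoActivity σ ρ) (hsDiameter σ N) (N + 1) x *
            (((N + 1 : ℕ) : ℝ)⁻¹ * ∑ i, χ (x i))) atTop (𝓝 (∫ x, χ x * ρ x)) := by
  obtain ⟨ηm, hηm0, hM⟩ := tendsto_freeEnergy_measurable hη₀ hFa hEq hfree hr hsol hbd hcont huniq hη₂ hexp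
  obtain ⟨ηc, hηc0, hηcη₀, C, hC0, hcalc⟩ := eos_calculus hη₀ hFa hEq
  set ηd : ℝ := min (min (ηm / 2) (ηc / 2)) (thresh r η₂ / 2) with hηd
  have hηd0 : 0 < ηd := lt_min (lt_min (by positivity) (by positivity)) (half_pos (thresh_pos hr hη₂))
  have hηd_m : 2 * ηd ≤ ηm := by
    have : ηd ≤ ηm / 2 := (min_le_left _ _).trans (min_le_left _ _); linarith
  have hηd_c : 2 * ηd ≤ ηc := by
    have : ηd ≤ ηc / 2 := (min_le_left _ _).trans (min_le_right _ _); linarith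
  have hηd_T : 2 * ηd ≤ thresh r η₂ := by
    have : ηd ≤ thresh r η₂ / 2 := min_le_right _ _; linarith
  have hT2 : thresh r η₂ ≤ η₂ / 2 := (min_le_left _ _).trans (min_le_left _ _)
  have hT16 : thresh r η₂ ≤ 1 / 16 := (min_le_left _ _).trans (min_le_right _ _)
  have hTr : thresh r η₂ ≤ r := by
    have h1 : thresh r η₂ ≤ r / (2 * (2 * (2 * Real.exp 1 + 1))) := (min_le_right _ _).trans (min_le_left _ _)
    have h2 : r / (2 * (2 * (2 * Real.exp 1 + 1))) ≤ r := by
      rw [div_le_iff₀ (by positivity)]; have := Real.exp_pos 1; nlinarith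
    exact h1.trans h2
  refine ⟨ηd, hηd0, fun σ hσ c hc ρ hρm hρlo hρ1 hpack χ hχ => ?_⟩
  have hσ3 : 0 < σ ^ 3 := pow_pos hσ 3
  obtain ⟨k, k₁, hk⟩ := hcalc σ hσ
  clear hcalc
  obtain ⟨Cχ, hCχ0, hCχ⟩ := exists_forall_abs_le_of_continuous hχ
  -- the band `[c/2, 2M]`, `M = η_d/σ³`
  obtain ⟨M, hMdef⟩ : ∃ M : ℝ, M = ηd / σ ^ 3 := ⟨_, rfl⟩
  have hMσ : M * σ ^ 3 = ηd := by rw [hMdef]; field_simp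
  have hρM : ∀ x, ρ x ≤ M := fun x => by rw [hMdef, le_div_iff₀ hσ3]; exact hpack x
  have hcM : c ≤ M := (hρlo 0).trans (hρM 0)
  have hM0 : 0 < M := hc.trans_le hcM
  have hρi : Integrable ρ := Integrable.of_bound hρm.aestronglyMeasurable M
    (Eventually.of_forall fun x => by rw [Real.norm_eq_abs, abs_of_pos (hc.trans_le (hρlo x))]; exact hρM x)
  obtain ⟨G, hG⟩ : ∃ G : ℝ → ℝ, G = fun s => hsExcessFreeEnergy (s * σ ^ 3) + s * σ ^ 3 *
    deriv hsExcessFreeEnergy (s * σ ^ 3) := ⟨_, rfl⟩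
  obtain ⟨hg, hhg⟩ : ∃ hg : ℝ → ℝ, hg = fun s => Real.log s + G s := ⟨_, rfl⟩
  obtain ⟨v, hv⟩ : ∃ v : ℝ → ℝ, v = fun s => s * (s * σ ^ 3 * deriv hsExcessFreeEnergy (s * σ ^ 3)) := ⟨_, rfl⟩
  obtain ⟨v₁', hv₁'⟩ : ∃ v₁' : ℝ → ℝ, v₁' = fun s => s * k s - 1 := ⟨_, rfl⟩
  have hband : ∀ s ∈ Icc (c / 2) (2 * M), 0 < s ∧ s * σ ^ 3 ≤ ηc ∧ s * σ ^ 3 < η₂ ∧ s * σ ^ 3 ≤ r := by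
    intro s hs
    have hs0 : 0 < s := by linarith [hs.1]
    have h2 : s * σ ^ 3 ≤ 2 * ηd := by
      calc s * σ ^ 3 ≤ 2 * M * σ ^ 3 := mul_le_mul_of_nonneg_right hs.2 hσ3.le
        _ = 2 * ηd := by rw [mul_assoc, hMσ]
    exact ⟨hs0, h2.trans hηd_c, by linarith, (h2.trans hηd_T).trans hTr⟩
  -- calculus on the band
  have hderiv : ∀ s ∈ Icc (c / 2) (2 * M), HasDerivAt hg (k s) s ∧ HasDerivAt k (k₁ s) s ∧
      HasDerivAt v (v₁' s) s ∧ HasDerivAt v₁' (deriv v₁' s) s ∧ 0 < k s ∧ k s ≤ 3 / c ∧ 1 / (4 * M) ≤ k s ∧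
      |k₁ s| ≤ 4 / c ^ 2 + C * σ ^ 6 ∧ |deriv v₁' s| ≤ C * σ ^ 3 ∧ HasDerivAt G (k s - 1 / s) s := by
    intro s hs
    obtain ⟨hs0, hsc, -, -⟩ := hband s hs
    obtain ⟨-, -, hh, hklo, hkhi, hk', hk₁b, hvd, d, hwd, hdb⟩ := hk s hs0 hsc
    have hkpos : 0 < k s := lt_of_lt_of_le (by positivity) hklo
    have hh' : HasDerivAt hg (k s) s := by rw [hhg, hG]; exact hh
    have hvd' : HasDerivAt v (v₁' s) s := by rw [hv, hv₁']; exact hvd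
    have hwd' : HasDerivAt v₁' d s := by rw [hv₁']; exact hwd
    refine ⟨hh', hk', hvd', ?_, hkpos, ?_, ?_, ?_, ?_, ?_⟩
    · rw [hwd'.deriv]; exact hwd'
    · calc k s ≤ 3 / (2 * s) := hkhi
        _ ≤ 3 / (2 * (c / 2)) := by gcongr; exact hs.1
        _ = 3 / c := by ring
    · calc 1 / (4 * M) = 1 / (2 * (2 * M)) := by ring
        _ ≤ 1 / (2 * s) := by gcongr; exact hs.2
        _ ≤ k s := hklo
    · calc |k₁ s| ≤ 1 / s ^ 2 + C * σ ^ 6 := hk₁b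
        _ ≤ 1 / (c / 2) ^ 2 + C * σ ^ 6 := by gcongr; exact hs.1
        _ = 4 / c ^ 2 + C * σ ^ 6 := by ring
    · rw [hwd'.deriv]; exact hdb
    · have hlog : HasDerivAt Real.log (1 / s) s := by rw [one_div]; exact Real.hasDerivAt_log hs0.ne'
      refine (hh'.sub hlog).congr_of_eventuallyEq (Eventually.of_forall fun t => ?_)
      show G t = hg t - Real.log t
      rw [hhg]; ring
  clear hk
  have hkcont : ContinuousOn k (Icc (c / 2) (2 * M)) := fun s hs => (hderiv s hs).2.1.continuousAt.continuousWithinAt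
  have hGcont : ContinuousOn G (Icc (c / 2) (2 * M)) := fun s hs =>
    (hderiv s hs).2.2.2.2.2.2.2.2.2.continuousAt.continuousWithinAt
  have hvcont : ContinuousOn v (Icc (c / 2) (2 * M)) := fun s hs => (hderiv s hs).2.2.1.continuousAt.continuousWithinAt
  obtain ⟨Bv, hBv⟩ := (isCompact_Icc : IsCompact (Icc (c / 2) (2 * M))).exists_bound_of_continuousOn hvcont
  have hvi : ∀ ρ' : T3 → ℝ, Measurable ρ' → (∀ x, ρ' x ∈ Icc (c / 2) (2 * M)) → Integrable fun x => v (ρ' x) :=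
    fun ρ' hm hmem => integrable_T3_of_abs_le (measurable_comp_of_continuousOn hvcont hm hmem)
      fun x => (Real.norm_eq_abs _).symm.le.trans (hBv _ (hmem x))
  -- the activity of a measurable density in the band
  have hthermo : ∀ ρ' : T3 → ℝ, thermoActivity σ ρ' = fun x => ρ' x * Real.exp (G (ρ' x)) := by
    intro ρ'; funext x; unfold thermoActivity; rw [hG]
  have hact : ∀ ρ' : T3 → ℝ, Measurable ρ' → (∀ x, ρ' x ∈ Icc (c / 2) (2 * M)) →
      Measurable (thermoActivity σ ρ') ∧ (∀ x, 0 < thermoActivity σ ρ' x) ∧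
      (∀ x, ρ' x ≤ thermoActivity σ ρ' x) ∧ (∀ x, thermoActivity σ ρ' x ≤ 4 * M) := by
    intro ρ' hρ'm hmem
    have hrep : ∀ x, thermoActivity σ ρ' x = ρ' x * Rf (ρ' x * σ ^ 3) := by
      intro x
      obtain ⟨hs0, -, hs2, -⟩ := hband _ (hmem x)
      unfold thermoActivity
      rw [hexp _ ⟨mul_pos hs0 hσ3, hs2⟩]
    have hRf : ∀ x, 1 ≤ Rf (ρ' x * σ ^ 3) ∧ Rf (ρ' x * σ ^ 3) ≤ 2 := by
      intro x
      obtain ⟨hs0, -, -, hs3⟩ := hband _ (hmem x)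
      exact hbd _ ⟨(mul_pos hs0 hσ3).le, hs3⟩
    refine ⟨?_, fun x => ?_, fun x => ?_, fun x => ?_⟩
    · rw [hthermo]
      exact hρ'm.mul (Real.measurable_exp.comp (measurable_comp_of_continuousOn hGcont hρ'm hmem))
    · rw [hrep x]; exact mul_pos (hband _ (hmem x)).1 (by linarith [(hRf x).1])
    · rw [hrep x]; exact le_mul_of_one_le_right (hband _ (hmem x)).1.le (hRf x).1
    · rw [hrep x]
      calc ρ' x * Rf (ρ' x * σ ^ 3) ≤ 2 * M * 2 :=
            mul_le_mul (hmem x).2 (hRf x).2 (by linarith [(hRf x).1]) (by linarith [(hmem x).1, (hmem x).2, hc])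
        _ = 4 * M := by ring
  -- the tilts between two activities
  have htilt : ∀ ρA ρB : T3 → ℝ, (∀ x, 0 < ρA x) → (∀ x, 0 < ρB x) →
      (fun y => thermoActivity σ ρA y * Real.exp (hg (ρB y) - hg (ρA y))) = thermoActivity σ ρB := by
    intro ρA ρB hA hB
    funext y
    rw [hhg, hG]
    exact (thermoActivity_eq_mul_exp σ hA hB y).symm
  have hρmem : ∀ x, ρ x ∈ Icc (c / 2) (2 * M) := fun x => ⟨by linarith [hρlo x], by linarith [hρM x, hM0]⟩
  obtain ⟨haρm, haρ0, haρlo, haρhi⟩ := hact ρ hρm hρmem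
  -- `σ ≤ 1/2` and `Z > 0`
  obtain ⟨x₁, hx₁⟩ := exists_one_le_of_integral_eq_one' hρi hρ1
  have hσηd : σ ^ 3 ≤ ηd := by have := hpack x₁; nlinarith
  have hσ2 : σ ≤ 1 / 2 := by
    have h16 : σ ^ 3 ≤ 1 / 16 := by linarith [hσηd, hηd_T, hT16]
    by_contra hcn
    push Not at hcn
    have : (1 / 2 : ℝ) ^ 3 < σ ^ 3 := pow_lt_pow_left₀ hcn (by norm_num) (by norm_num)
    nlinarith
  have hZ : ∀ N, 0 < posPartition (thermoActivity σ ρ) (hsDiameter σ N) (N + 1) := fun N =>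
    posPartition_pos_of_ge haρm (half_pos hc) (fun y => (hρmem y).1.trans (haρlo y)) haρhi hσ2 N
  ------------------------------------------------------------------
  -- the direction `w = (χ - κ)/k(ρ)`, `∫ w = 0`
  ------------------------------------------------------------------
  have hkρm : Measurable fun x => k (ρ x) := measurable_comp_of_continuousOn hkcont hρm hρmem
  have hkρpos : ∀ x, 0 < k (ρ x) := fun x => (hderiv _ (hρmem x)).2.2.2.2.1
  have hkρhi : ∀ x, k (ρ x) ≤ 3 / c := fun x => (hderiv _ (hρmem x)).2.2.2.2.2.1
  have hkρlo : ∀ x, 1 / (4 * M) ≤ k (ρ x) := fun x => (hderiv _ (hρmem x)).2.2.2.2.2.2.1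
  have hikpos : ∀ x, 0 < 1 / k (ρ x) := fun x => one_div_pos.2 (hkρpos x)
  have hinvk : ∀ x, c / 3 ≤ 1 / k (ρ x) ∧ 1 / k (ρ x) ≤ 4 * M := by
    intro x
    constructor
    · rw [le_div_iff₀ (hkρpos x)]
      calc c / 3 * k (ρ x) ≤ c / 3 * (3 / c) := by gcongr; exact hkρhi x
        _ = 1 := by field_simp
    · rw [div_le_iff₀ (hkρpos x)]
      calc (1 : ℝ) = 4 * M * (1 / (4 * M)) := by field_simp
        _ ≤ 4 * M * k (ρ x) := by gcongr; exact hkρlo x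
  have hinvk_m : Measurable fun x => 1 / k (ρ x) := measurable_const.div hkρm
  have hinvk_i : Integrable fun x => 1 / k (ρ x) :=
    integrable_T3_of_abs_le hinvk_m fun x => by rw [abs_of_pos (hikpos x)]; exact (hinvk x).2
  have hχk_i : Integrable fun x => χ x / k (ρ x) :=
    integrable_T3_of_abs_le (hχ.measurable.div hkρm) (K := Cχ * (4 * M)) fun x => by
      rw [div_eq_mul_one_div, abs_mul, abs_of_pos (hikpos x)]
      exact mul_le_mul (hCχ x) (hinvk x).2 (hikpos x).le hCχ0
  obtain ⟨I₁, hI₁⟩ : ∃ I : ℝ, I = ∫ x, 1 / k (ρ x) := ⟨_, rfl⟩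
  obtain ⟨Iχ, hIχ⟩ : ∃ I : ℝ, I = ∫ x, χ x / k (ρ x) := ⟨_, rfl⟩
  have hI₁pos : 0 < I₁ := by
    have h : c / 3 ≤ I₁ := by
      calc c / 3 = ∫ _ : T3, c / 3 := by rw [integral_const, smul_eq_mul, probReal_univ, one_mul]
        _ ≤ I₁ := by rw [hI₁]; exact integral_mono (integrable_const _) hinvk_i fun x => (hinvk x).1
    linarith
  obtain ⟨κ, hκ⟩ : ∃ κ : ℝ, κ = Iχ / I₁ := ⟨_, rfl⟩
  have hIχ_le : |Iχ| ≤ Cχ * I₁ := by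
    rw [hIχ, hI₁, ← integral_const_mul]
    refine (abs_integral_le_integral_abs).trans (integral_mono hχk_i.abs (hinvk_i.const_mul _) fun x => ?_)
    dsimp only
    rw [div_eq_mul_one_div, abs_mul, abs_of_pos (hikpos x)]
    exact mul_le_mul_of_nonneg_right (hCχ x) (hikpos x).le
  have hκb : |κ| ≤ Cχ := by
    rw [hκ, abs_div, abs_of_pos hI₁pos, div_le_iff₀ hI₁pos]
    exact hIχ_le
  obtain ⟨w, hw⟩ : ∃ w : T3 → ℝ, w = fun x => (χ x - κ) / k (ρ x) := ⟨_, rfl⟩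
  have hwm : Measurable w := by rw [hw]; exact (hχ.measurable.sub measurable_const).div hkρm
  obtain ⟨W, hW⟩ : ∃ W : ℝ, W = 2 * Cχ * (4 * M) := ⟨_, rfl⟩
  have hW0 : 0 ≤ W := by rw [hW]; positivity
  have hwW : ∀ x, |w x| ≤ W := by
    intro x
    rw [hw, hW]; dsimp only
    rw [div_eq_mul_one_div, abs_mul, abs_of_pos (hikpos x)]
    refine mul_le_mul ?_ (hinvk x).2 (hikpos x).le (by positivity)
    calc |χ x - κ| ≤ |χ x| + |κ| := abs_sub _ _
      _ ≤ Cχ + Cχ := add_le_add (hCχ x) hκb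
      _ = 2 * Cχ := by ring
  have hwi : Integrable w := integrable_T3_of_abs_le hwm hwW
  have hwsq : ∀ y, w y ^ 2 ≤ W ^ 2 := fun y => by
    rw [← sq_abs (w y)]; exact pow_le_pow_left₀ (abs_nonneg _) (hwW y) 2
  have hkw : ∀ x, k (ρ x) * w x = χ x - κ := fun x => by
    rw [hw]; dsimp only
    rw [mul_div_assoc', mul_comm (k (ρ x)), mul_div_assoc, div_self (hkρpos x).ne', mul_one]
  have hw0 : ∫ x, w x = 0 := by
    have h : w = fun x => χ x / k (ρ x) - κ * (1 / k (ρ x)) := by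
      rw [hw]; funext x; field_simp
    rw [h, integral_sub hχk_i (hinvk_i.const_mul κ), integral_const_mul, ← hIχ, ← hI₁, hκ,
      div_mul_cancel₀ _ hI₁pos.ne', sub_self]
  ------------------------------------------------------------------
  -- the perturbed profiles `ρ_s = ρ + s w`, `|s| ≤ s₀`
  ------------------------------------------------------------------
  obtain ⟨s₀, hs₀⟩ : ∃ s₀ : ℝ, s₀ = min (c / (2 * (W + 1))) (M / (W + 1)) := ⟨_, rfl⟩
  have hs₀pos : 0 < s₀ := by rw [hs₀]; exact lt_min (by positivity) (by positivity)
  have hs₀W : s₀ * W ≤ c / 2 ∧ s₀ * W ≤ M := by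
    have hW1 : 0 < W + 1 := by linarith
    constructor
    · calc s₀ * W ≤ c / (2 * (W + 1)) * W := by rw [hs₀]; gcongr; exact min_le_left _ _
        _ ≤ c / (2 * (W + 1)) * (W + 1) := by gcongr; linarith
        _ = c / 2 := by field_simp
    · calc s₀ * W ≤ M / (W + 1) * W := by rw [hs₀]; gcongr; exact min_le_right _ _
        _ ≤ M / (W + 1) * (W + 1) := by gcongr; linarith
        _ = M := by field_simp
  have hpert : ∀ s : ℝ, |s| ≤ s₀ → (Measurable fun x => ρ x + s * w x) ∧
      (∀ x, ρ x + s * w x ∈ Icc (c / 2) (2 * M)) ∧ (∫ x, ρ x + s * w x) = 1 ∧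
      (∀ x, c / 2 ≤ ρ x + s * w x) ∧ (∀ x, (ρ x + s * w x) * σ ^ 3 ≤ ηm) ∧ (∀ x, 0 < ρ x + s * w x) := by
    intro s hs
    have hsw : ∀ x, |s * w x| ≤ s₀ * W := fun x => by
      rw [abs_mul]; exact mul_le_mul hs (hwW x) (abs_nonneg _) hs₀pos.le
    have hmem : ∀ x, ρ x + s * w x ∈ Icc (c / 2) (2 * M) := by
      intro x
      have h1 := abs_le.1 ((hsw x).trans hs₀W.1)
      have h2 := abs_le.1 ((hsw x).trans hs₀W.2)
      exact ⟨by linarith [hρlo x], by linarith [hρM x]⟩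
    refine ⟨hρm.add (hwm.const_mul s), hmem, ?_, fun x => (hmem x).1, fun x => ?_, fun x => (hband _ (hmem x)).1⟩
    · rw [integral_add hρi (hwi.const_mul s), integral_const_mul, hρ1, hw0, mul_zero, add_zero]
    · calc (ρ x + s * w x) * σ ^ 3 ≤ 2 * M * σ ^ 3 := mul_le_mul_of_nonneg_right (hmem x).2 hσ3.le
        _ = 2 * ηd := by rw [mul_assoc, hMσ]
        _ ≤ ηm := hηd_m
  ------------------------------------------------------------------
  -- the finite-`N` convexity inequality (★)
  ------------------------------------------------------------------
  obtain ⟨K₂, hK₂⟩ : ∃ K : ℝ, K = 4 / c ^ 2 + C * σ ^ 6 := ⟨_, rfl⟩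
  have hK₂0 : 0 ≤ K₂ := by rw [hK₂]; positivity
  obtain ⟨Λ, hΛ⟩ : ∃ Λ : ℝ → ℕ → ℝ, Λ = fun s N => (((N + 1 : ℕ) : ℝ))⁻¹ *
    Real.log (posPartition (thermoActivity σ (fun x => ρ x + s * w x)) (hsDiameter σ N) (N + 1)) := ⟨_, rfl⟩
  have hρ0w : (fun x => ρ x + 0 * w x) = ρ := by funext x; ring
  have hhgm : ∀ ρ' : T3 → ℝ, Measurable ρ' → (∀ x, ρ' x ∈ Icc (c / 2) (2 * M)) → Measurable fun y => hg (ρ' y) := by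
    intro ρ' h1 h2
    rw [hhg]
    exact (Real.measurable_log.comp h1).add (measurable_comp_of_continuousOn hGcont h1 h2)
  have hχκ : ∀ y, |χ y - κ| ≤ 2 * Cχ := fun y => by
    calc |χ y - κ| ≤ |χ y| + |κ| := abs_sub _ _
      _ ≤ Cχ + Cχ := add_le_add (hCχ y) hκb
      _ = 2 * Cχ := by ring
  have hstar : ∀ s : ℝ, |s| ≤ s₀ → ∀ N : ℕ,
      s * ((posPartition (thermoActivity σ ρ) (hsDiameter σ N) (N + 1))⁻¹ *
        ∫ x, posWeight (thermoActivity σ ρ) (hsDiameter σ N) (N + 1) x * (((N + 1 : ℕ) : ℝ)⁻¹ * ∑ i, χ (x i))) ≤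
      Λ s N - Λ 0 N + s * κ + K₂ * W ^ 2 * s ^ 2 := by
    intro s hs N
    obtain ⟨hρsm, hρsmem, -, -, -, hρs0⟩ := hpert s hs
    have hssq : s ^ 2 ≤ s₀ ^ 2 := by
      rw [← sq_abs s]; exact pow_le_pow_left₀ (abs_nonneg _) hs 2
    -- the tilt and its Taylor expansion
    obtain ⟨ψ, hψ⟩ : ∃ ψ : T3 → ℝ, ψ = fun y => hg (ρ y + s * w y) - hg (ρ y) := ⟨_, rfl⟩
    have hψm : Measurable ψ := by rw [hψ]; exact (hhgm _ hρsm hρsmem).sub (hhgm ρ hρm hρmem)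
    have htaylor : ∀ y, |ψ y - s * (χ y - κ)| ≤ K₂ * W ^ 2 * s ^ 2 := by
      intro y
      have hseg : uIcc (ρ y) (ρ y + s * w y) ⊆ Icc (c / 2) (2 * M) := uIcc_subset_Icc (hρmem y) (hρsmem y)
      have h := abs_sub_sub_mul_le_of_deriv (f := hg) (f₁ := k) (f₂ := k₁) (K := K₂) (x := ρ y) (y := ρ y + s * w y)
        (fun t ht => (hderiv t (hseg ht)).1) (fun t ht => (hderiv t (hseg ht)).2.1)
        (fun t ht => by rw [hK₂]; exact (hderiv t (hseg ht)).2.2.2.2.2.2.2.1)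
      have e1 : ρ y + s * w y - ρ y = s * w y := by ring
      rw [e1, ← mul_assoc, mul_comm (k (ρ y)) s, mul_assoc, hkw y] at h
      calc |ψ y - s * (χ y - κ)| = |hg (ρ y + s * w y) - hg (ρ y) - s * (χ y - κ)| := by rw [hψ]
        _ ≤ K₂ * (s * w y) ^ 2 := h
        _ = K₂ * (w y ^ 2 * s ^ 2) := by ring
        _ ≤ K₂ * (W ^ 2 * s ^ 2) :=
            mul_le_mul_of_nonneg_left (mul_le_mul_of_nonneg_right (hwsq y) (sq_nonneg s)) hK₂0
        _ = K₂ * W ^ 2 * s ^ 2 := by ring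
    have hψB : ∀ y, |ψ y| ≤ s₀ * (2 * Cχ) + K₂ * W ^ 2 * s₀ ^ 2 := by
      intro y
      have h1 := htaylor y
      have h2 : |s * (χ y - κ)| ≤ s₀ * (2 * Cχ) := by
        rw [abs_mul]; exact mul_le_mul hs (hχκ y) (abs_nonneg _) hs₀pos.le
      have h3 : K₂ * W ^ 2 * s ^ 2 ≤ K₂ * W ^ 2 * s₀ ^ 2 := mul_le_mul_of_nonneg_left hssq (by positivity)
      calc |ψ y| = |(ψ y - s * (χ y - κ)) + s * (χ y - κ)| := by rw [sub_add_cancel]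
        _ ≤ |ψ y - s * (χ y - κ)| + |s * (χ y - κ)| := abs_add_le _ _
        _ ≤ (s₀ * (2 * Cχ) + K₂ * W ^ 2 * s₀ ^ 2) := by linarith
    have hdom : ∀ y, s * (χ y - κ) - K₂ * W ^ 2 * s ^ 2 ≤ ψ y := fun y => by
      have h := (abs_le.1 (htaylor y)).1; linarith
    -- the convexity inequality of file VIIIa
    have h := gibbsMean_perturb_le haρm (fun y => (haρ0 y).le) haρhi (hsDiameter σ N) (Nat.succ_pos N) (hZ N)
      hψm hψB hχ.measurable hCχ (by positivity) hdom
    have hfun : (fun y => thermoActivity σ ρ y * Real.exp (ψ y)) = thermoActivity σ (fun x => ρ x + s * w x) := by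
      rw [hψ]; exact htilt ρ _ (fun x => hc.trans_le (hρlo x)) hρs0
    rw [hfun] at h
    rw [hΛ]; dsimp only
    rw [hρ0w]
    linarith
  ------------------------------------------------------------------
  -- the limits (clause (B1), file VII) and the functional Taylor bound (★★)
  ------------------------------------------------------------------
  obtain ⟨V, hV⟩ : ∃ V : ℝ → ℝ, V = fun s => ∫ x, v (ρ x + s * w x) := ⟨_, rfl⟩
  have hVlim : ∀ s : ℝ, |s| ≤ s₀ → Tendsto (Λ s) atTop (𝓝 (V s)) := by
    intro s hs
    obtain ⟨hρsm, -, hρs1, hρslo, hρspack, -⟩ := hpert s hs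
    have h := hM σ hσ (c / 2) (half_pos hc) (fun x => ρ x + s * w x) hρsm hρslo hρs1 hρspack
    rw [hΛ, hV, hv]
    exact h
  obtain ⟨K₃, hK₃⟩ : ∃ K : ℝ, K = C * σ ^ 3 := ⟨_, rfl⟩
  have hK₃0 : 0 ≤ K₃ := by rw [hK₃]; positivity
  have hχρ_i : Integrable fun x => ρ x * χ x :=
    hρi.mul_of_top_left (memLp_top_of_bound hχ.measurable.aestronglyMeasurable Cχ
      (Eventually.of_forall fun x => (Real.norm_eq_abs _).trans_le (hCχ x)))
  obtain ⟨J, hJdef⟩ : ∃ J : ℝ, J = ∫ x, χ x * ρ x := ⟨_, rfl⟩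
  have hstar2 : ∀ s : ℝ, |s| ≤ s₀ → |V s - V 0 - s * (J - κ)| ≤ K₃ * W ^ 2 * s ^ 2 := by
    intro s hs
    obtain ⟨hρsm, hρsmem, -, -, -, -⟩ := hpert s hs
    -- the linear term: `∫ v₁'(ρ) (s w) = s (J - κ)`
    have hv₁'ρ : ∀ x, v₁' (ρ x) * (s * w x) = s * (ρ x * χ x - κ * ρ x - w x) := by
      intro x
      rw [hv₁']; dsimp only
      have := hkw x
      calc (ρ x * k (ρ x) - 1) * (s * w x) = s * (ρ x * (k (ρ x) * w x) - w x) := by ring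
        _ = s * (ρ x * χ x - κ * ρ x - w x) := by rw [this]; ring
    have hi_a : Integrable fun x => ρ x * χ x - κ * ρ x := hχρ_i.sub (hρi.const_mul κ)
    have hlin_i : Integrable fun x => ρ x * χ x - κ * ρ x - w x := hi_a.sub hwi
    have hi₃ : Integrable fun x => v₁' (ρ x) * (s * w x) :=
      (hlin_i.const_mul s).congr (Eventually.of_forall fun x => (hv₁'ρ x).symm)
    have hlin : ∫ x, v₁' (ρ x) * (s * w x) = s * (J - κ) := by
      simp_rw [hv₁'ρ]
      rw [integral_const_mul, integral_sub hi_a hwi, integral_sub hχρ_i (hρi.const_mul κ),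
        integral_const_mul, hρ1, hw0, hJdef, mul_one, sub_zero]
      congr 2
      exact integral_congr_ae (Eventually.of_forall fun x => mul_comm _ _)
    have h := integral_taylor_le (fun t ht => (hderiv t ht).2.2.1) (fun t ht => (hderiv t ht).2.2.2.1)
      (fun t ht => by rw [hK₃]; exact (hderiv t ht).2.2.2.2.2.2.2.2.1) hK₃0 hρmem hρsmem hwW
      (hvi _ hρsm hρsmem) (hvi _ hρm hρmem) hi₃
    rw [hlin] at h
    rw [hV]; dsimp only
    simp only [zero_mul, add_zero]
    exact h
  ------------------------------------------------------------------
  -- conclusion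
  ------------------------------------------------------------------
  have hfin := tendsto_of_twoSided_perturbation (EN := fun N => (posPartition (thermoActivity σ ρ) (hsDiameter σ N) (N + 1))⁻¹ *
      ∫ x, posWeight (thermoActivity σ ρ) (hsDiameter σ N) (N + 1) x * (((N + 1 : ℕ) : ℝ)⁻¹ * ∑ i, χ (x i)))
    hs₀pos (by positivity : 0 ≤ K₂ * W ^ 2) (by positivity : 0 ≤ K₃ * W ^ 2) hstar hVlim hstar2
  rw [hJdef] at hfin
  exact hfin

end Core

end Summit.AtomisticToContinuum.HydrodynamicLimit.Theorems.HardSphereLDA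

end
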